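import Literature.NumberTheory.Weil1964.ArchWeilContinuityKAK
import Literature.RepresentationTheory.KonnoKonno2007.RealUnitaryDualPair
import Literature.NumberTheory.Automorphic.IwasawaDecompositionArchimedean
import HarnessLib

/-!
# (w1) for the real unitary dual pair `U(P,Q) × U(R,S) → Sp(𝕎)`: assembly of strong continuity from the vacuum character and `KAK` (Folland 1989 §4.2; Knapp 2002 Thm 7.39; Konno–Konno 2007 §3)

Topic `RepresentationTheory/KonnoKonno2007`; namespace `Literature.RepresentationTheory.KonnoKonno2007.RealDualPair`.
Continuation of `Literature.RepresentationTheory.KonnoKonno2007.RealUnitaryDualPair` (the instance `Ginf P Q R S =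
UForm P Q × UForm R S`, `ι𝕎`, `κ = kV × kV`, `ι𝕎_κ`) and of `Literature.NumberTheory.Weil1964.ArchWeilContinuityKAK`
(strong continuity (w1) of a Heisenberg-covariant representation with unitary lifts from (K) a continuous vacuum orbit
on a compact subgroup, (A) an explicit continuous one-parameter implementer family, (W) a Weyl element, (M) a proper
surjective `KAK` map).

**The point of this file.**  For a representation `ω` of the PRODUCT `G_∞ = U(P,Q) × U(R,S)` on `𝓢(ℝ^{DPIdx})` which is
Heisenberg-covariant over `ι𝕎` with unitary lifts ((w2)+(w2′) of `IsArchWeilDatum`) and whose vacuum orbit on the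
maximal compact `K_V × K_W` is continuous (e.g. `ω(κ k) h₀ = vacScalar e k • h₀`, the printed vacuum character), strong
continuity (w1) — hence `IsArchWeilDatum (ι𝕎 P Q R S) ω` — follows as soon as

* the factor `U(P,Q)` carries ONE hyperbolic one-parameter subgroup `a : ℝ → U(P,Q)` with an explicit jointly
  continuous covariant implementer family `W_A` on `𝓢` (the tree's `hypOp`), a Weyl element in `K_V = U(P) × U(Q)`
  reversing it, and `(k₁, t, k₂) ↦ k₁ a(t) k₂` a proper surjection `K_V × ℝ × K_V → U(P,Q)` (real rank one: `|Q| = 1`);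
* the factor `U(R,S)` is COMPACT in the precise sense `kV R S : U(R) × U(S) → U(R,S)` surjective — automatic when
  `R` or `S` is empty (`UForm.kV_surjective_of_isEmpty_right/left`), i.e. for a definite line or space.

No product-`KAK` is needed: `ω(g_V, g_W) = ω(g_V, 1) ∘ ω(1, g_W)` and joint continuity composes
(`continuous_uncurry_prod`); the `U(P,Q)`-slice is `ArchWeilContinuityKAK.continuous_uncurry_of_kak`, the
`U(R,S)`-slice descends the vacuum-orbit block along the proper surjection `kV R S` (compact source).  The purely
compact case (both `kV` surjective: definite places) is `isArchWeilDatum_junction_of_compact`.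

* §1 generic assembly lemmas: `continuous_uncurry_prod`, `continuous_uncurry_of_kak_unitary` (joint form of
  `isArchWeilDatum_of_kak_unitary`), `continuous_uncurry_of_compact_unitary`.
* §2 the compact factor: `compactSpace_matrixUnitaryGroup`, `UForm.kV_surjective_of_isEmpty_right/left`, `UForm.isProperMap_kV`,
  `continuous_vacScalar`.
* §3 the junction: **`continuous_uncurry_junction`**, **`isArchWeilDatum_junction`** (boost in `U(P,Q)`, `U(R,S)` compact),
  **`isArchWeilDatum_junction_of_vacScalar`** (vacuum hypothesis in the printed form `ω(κ k) h₀ = vacScalar e k • h₀`),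
  **`isArchWeilDatum_junction_of_compact`**.

Everything is PROVED from Mathlib and the imported tree files; no cited fact is a hypothesis.

## References

* [Folland1989] G. B. Folland, *Harmonic Analysis in Phase Space*, Annals of Mathematics Studies 122, Princeton
  University Press, 1989: §4.2, (4.23)–(4.24) and the Schur remark p. 156; Prop. (4.39) (doi:10.1515/9781400882427).
* [Knapp2002] A. W. Knapp, *Lie Groups Beyond an Introduction*, 2nd ed., Progress in Mathematics 140, Birkhäuser,
  2002: Theorem 7.39 (`G = KAK`), p. 457.
* [KonnoKonno2007] K. Konno, T. Konno, *On doubling construction for real unitary dual pairs*, Kyushu J. Math. 61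
  (2007) 35–82: §3.1 (3.1) (`ι_{V,W}`, `K_V × K_W`), §3.3, Lemma 5.2 (doi:10.2206/kyushujm.61.35).
-/

noncomputable section

open MeasureTheory Complex SchwartzMap Matrix
open scoped InnerProductSpace ComplexConjugate Real

namespace Literature.RepresentationTheory.KonnoKonno2007

namespace RealDualPair

open Literature.Analysis.SegalBargmann Literature.RepresentationTheory.HeisenbergGroup
open Literature.NumberTheory.Weil1964 Literature.NumberTheory.Automorphic
open Literature.NumberTheory.Automorphic.UnitaryGroup

variable {σ : Type*} [Fintype σ] [DecidableEq σ]

local notation "L2R" σ => Lp ℂ 2 (volume : Measure (σ → ℝ))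
local notation "SR" σ => SchwartzMap (σ → ℝ) ℂ
local notation "PV" σ => (σ → ℝ) × (σ → ℝ)
local notation "SpR" σ => symplecticGroup (polar (dotPairing σ))

/-- Notation (NOT a definition): `HasUnitaryLift[σ] A` abbreviates the (w2′) clause shape of
`IsArchWeilDatum.exists_lift`. -/
local notation "HasUnitaryLift[" σ "]" A:max =>
  ∃ U : Lp ℂ 2 (volume : Measure (σ → ℝ)) ≃ₗᵢ[ℂ] Lp ℂ 2 (volume : Measure (σ → ℝ)),
    LiftsTo A ((LinearIsometryEquiv.toContinuousLinearEquiv U :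
        Lp ℂ 2 (volume : Measure (σ → ℝ)) ≃L[ℂ] Lp ℂ 2 (volume : Measure (σ → ℝ))) :
      Lp ℂ 2 (volume : Measure (σ → ℝ)) →L[ℂ] Lp ℂ 2 (volume : Measure (σ → ℝ)))

/-! ## 1. Generic assembly lemmas -/

section Generic

/-- **Joint continuity on a product group from the two slices**: `ω(g₁, g₂) = ω(g₁, 1) ∘ ω(1, g₂)`. [folklore] -/
theorem continuous_uncurry_prod {G₁ G₂ : Type*} [Monoid G₁] [Monoid G₂] [TopologicalSpace G₁] [TopologicalSpace G₂]
    {V : Type*} [AddCommMonoid V] [Module ℂ V] [TopologicalSpace V] (ω : Representation ℂ (G₁ × G₂) V)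
    (h₁ : Continuous fun x : G₁ × V => ω (x.1, 1) x.2) (h₂ : Continuous fun x : G₂ × V => ω (1, x.1) x.2) :
    Continuous fun x : (G₁ × G₂) × V => ω x.1 x.2 := by
  have e : ∀ (g : G₁ × G₂) (v : V), ω g v = ω (g.1, 1) (ω (1, g.2) v) := fun g v => by
    rw [← Module.End.mul_apply, ← map_mul, Prod.mk_mul_mk, mul_one, one_mul]
  have e' : (fun x : (G₁ × G₂) × V => ω x.1 x.2) = fun x => ω (x.1.1, 1) (ω (1, x.1.2) x.2) :=
    funext fun x => e x.1 x.2
  rw [e']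
  exact h₁.comp ((continuous_fst.comp continuous_fst).prodMk
    (h₂.comp ((continuous_snd.comp continuous_fst).prodMk continuous_snd)))

variable {G : Type*} [Group G] [TopologicalSpace G] {K : Type*} [Group K] [TopologicalSpace K]

/-- **(w1), joint form, with (K) discharged by `μ₀ = unitaryOpPi`** — the joint-continuity version of
`isArchWeilDatum_of_kak_unitary`. [cite: Folland1989, §4.2, the Schur remark p. 156; Prop. (4.39)] -/
theorem continuous_uncurry_of_kak_unitary {ι𝕎 : G →* SpR σ} (ω : Representation ℂ G (SR σ))
    (hcov : IsPhaseCovariantS (fun g => ⇑((ι𝕎 g).1 : (PV σ) ≃ₗ[ℝ] PV σ)) (fun g => ω g))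
    (hlift : ∀ g, HasUnitaryLift[σ] (ω g))
    (κ : K →* G) (ιK : K → Matrix.unitaryGroup σ ℂ) (hιK : Continuous ιK)
    (hreal : ∀ k pq, ((ι𝕎 (κ k)).1 : (PV σ) ≃ₗ[ℝ] PV σ) pq = realify (ιK k) pq)
    (hvac : Continuous fun k => ω (κ k) (hermitePi 0))
    (a : ℝ → G) (ha : ∀ s t, a (s + t) = a s * a t)
    {WA : ℝ → ((SR σ) →L[ℂ] SR σ)}
    (hWA : IsPhaseCovariantS (fun t => ⇑((ι𝕎 (a t)).1 : (PV σ) ≃ₗ[ℝ] PV σ))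
      (fun t => ((WA t : (SR σ) →L[ℂ] SR σ) : (SR σ) →ₗ[ℂ] SR σ)))
    (hWAl : ∀ t, HasUnitaryLift[σ] ((WA t : (SR σ) →L[ℂ] SR σ) : (SR σ) →ₗ[ℂ] SR σ))
    (hWAc : Continuous fun x : ℝ × SR σ => WA x.1 x.2)
    (hWA_add : ∀ s t f, WA (s + t) f = WA s (WA t f))
    (w : K) (hw : ∀ t, κ w * a t * (κ w)⁻¹ = a (-t))
    (hm : IsProperMap fun p : K × ℝ × K => κ p.1 * a p.2.1 * κ p.2.2)
    (hsurj : Function.Surjective fun p : K × ℝ × K => κ p.1 * a p.2.1 * κ p.2.2) :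
    Continuous fun x : G × SR σ => ω x.1 x.2 := by
  have hWKc : Continuous fun x : K × SR σ => unitaryOpPi (ιK x.1) x.2 :=
    continuous_unitaryOpPi_uncurry.comp (f := fun x : K × (SR σ) => (ιK x.1, x.2))
      ((hιK.comp continuous_fst).prodMk continuous_snd)
  have hWKl : ∀ k, HasUnitaryLift[σ] ((unitaryOpPi (ιK k) : (SR σ) →L[ℂ] SR σ) : (SR σ) →ₗ[ℂ] SR σ) :=
    fun k => ⟨_, liftsTo_unitaryOpPi (ιK k)⟩
  refine continuous_uncurry_of_kak ω (symplecticPhaseMap_mul ι𝕎) hcov hlift κ a ha (WK := fun k => unitaryOpPi (ιK k))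
    ?_ hWKl hWKc hvac hWA hWAl hWAc hWA_add w hw hm hsurj
  intro k p q f
  have h1 := (isRhoCovariantS_unitaryOpPi ιK) k p q f
  beta_reduce at h1 ⊢
  rw [hreal k (p, q)]
  exact h1

/-- **The compact slice, joint form**: if `κ : K → G` is a proper surjection (e.g. `K` compact, `κ` onto), on `κ(K)` the
symplectic action is through unitary matrices `ιK k` (continuous in `k`), and the vacuum orbit `k ↦ ω(κ k) h₀` is
continuous, then `(g, f) ↦ ω g f` is jointly continuous. [cite: Folland1989, §4.2, the Schur remark p. 156; Prop. (4.39)] -/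
theorem continuous_uncurry_of_compact_unitary {ι𝕎 : G →* SpR σ} (ω : Representation ℂ G (SR σ))
    (hcov : IsPhaseCovariantS (fun g => ⇑((ι𝕎 g).1 : (PV σ) ≃ₗ[ℝ] PV σ)) (fun g => ω g))
    (hlift : ∀ g, HasUnitaryLift[σ] (ω g))
    (κ : K →* G) (hκ : IsProperMap κ) (hκs : Function.Surjective κ)
    (ιK : K → Matrix.unitaryGroup σ ℂ) (hιK : Continuous ιK)
    (hreal : ∀ k pq, ((ι𝕎 (κ k)).1 : (PV σ) ≃ₗ[ℝ] PV σ) pq = realify (ιK k) pq)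
    (hvac : Continuous fun k => ω (κ k) (hermitePi 0)) :
    Continuous fun x : G × SR σ => ω x.1 x.2 := by
  have hWc : Continuous fun x : K × SR σ => unitaryOpPi (ιK x.1) x.2 :=
    continuous_unitaryOpPi_uncurry.comp (f := fun x : K × (SR σ) => (ιK x.1, x.2))
      ((hιK.comp continuous_fst).prodMk continuous_snd)
  have hWl : ∀ k, HasUnitaryLift[σ] ((unitaryOpPi (ιK k) : (SR σ) →L[ℂ] SR σ) : (SR σ) →ₗ[ℂ] SR σ) :=
    fun k => ⟨_, liftsTo_unitaryOpPi (ιK k)⟩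
  have hcovK : IsPhaseCovariantS (fun k => ⇑((ι𝕎 (κ k)).1 : (PV σ) ≃ₗ[ℝ] PV σ)) (fun k => ω (κ k)) :=
    fun k p q f => hcov (κ k) p q f
  have hW : IsPhaseCovariantS (fun k => ⇑((ι𝕎 (κ k)).1 : (PV σ) ≃ₗ[ℝ] PV σ))
      (fun k => ((unitaryOpPi (ιK k) : (SR σ) →L[ℂ] SR σ) : (SR σ) →ₗ[ℂ] SR σ)) := by
    intro k p q f
    have h1 := (isRhoCovariantS_unitaryOpPi ιK) k p q f
    beta_reduce at h1 ⊢
    rw [hreal k (p, q)]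
    exact h1
  exact continuous_uncurry_of_isProperMap hκ hκs (F := fun g f => ω g f)
    (continuous_uncurry_of_vacuum hcovK (fun k => hlift (κ k)) hvac hW hWl hWc)

end Generic

/-! ## 2. The compact factor -/

section CompactFactor

/-- `U(n)` is a compact space (from the tree's `Matrix.isCompact_unitaryGroup`). [folklore] -/
theorem compactSpace_matrixUnitaryGroup (n : Type*) [Fintype n] [DecidableEq n] : CompactSpace (Matrix.unitaryGroup n ℂ) :=
  isCompact_iff_compactSpace.mp Matrix.isCompact_unitaryGroup

variable {α β : Type*} [Fintype α] [DecidableEq α] [Fintype β] [DecidableEq β]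

/-- **A definite unitary group is its own maximal compact**: for `β` empty, `kV α β : U(α) × U(β) → U(α, β)` is onto.
[folklore] -/
theorem UForm.kV_surjective_of_isEmpty_right [IsEmpty β] : Function.Surjective (UForm.kV α β) := by
  intro g
  set M : Matrix (α ⊕ β) (α ⊕ β) ℂ := (((g : UForm α β) : GL (α ⊕ β) ℂ) : Matrix (α ⊕ β) (α ⊕ β) ℂ) with hM
  have hg : Mᴴ * signForm α β * M = signForm α β :=
    (mem_unitaryGroupOfForm_star_iff_conjTranspose (signForm α β) _).1 g.2
  let A : Matrix α α ℂ := fun i j => M (Sum.inl i) (Sum.inl j)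
  have hA : A ∈ Matrix.unitaryGroup α ℂ := by
    rw [Matrix.mem_unitaryGroup_iff']
    ext i j
    have h1 := congrFun (congrFun hg (Sum.inl i)) (Sum.inl j)
    simp only [Matrix.mul_apply, Fintype.sum_sum_type, Finset.univ_eq_empty, Finset.sum_empty, add_zero,
      Matrix.conjTranspose_apply, Matrix.fromBlocks_apply₁₁, Matrix.one_apply, mul_ite, mul_one, mul_zero,
      Finset.sum_ite_eq', Finset.mem_univ, if_true] at h1
    rw [Matrix.star_eq_conjTranspose, Matrix.mul_apply]
    simpa only [Matrix.conjTranspose_apply, Matrix.one_apply, A] using h1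
  refine ⟨(⟨A, hA⟩, 1), Subtype.ext (Units.ext ?_)⟩
  rw [UForm.coe_kV]
  ext (i | i) (j | j)
  · rfl
  · exact isEmptyElim j
  · exact isEmptyElim i
  · exact isEmptyElim i

/-- … and for `α` empty (negative definite form). [folklore] -/
theorem UForm.kV_surjective_of_isEmpty_left [IsEmpty α] : Function.Surjective (UForm.kV α β) := by
  intro g
  set M : Matrix (α ⊕ β) (α ⊕ β) ℂ := (((g : UForm α β) : GL (α ⊕ β) ℂ) : Matrix (α ⊕ β) (α ⊕ β) ℂ) with hM
  have hg : Mᴴ * signForm α β * M = signForm α β :=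
    (mem_unitaryGroupOfForm_star_iff_conjTranspose (signForm α β) _).1 g.2
  let D : Matrix β β ℂ := fun i j => M (Sum.inr i) (Sum.inr j)
  have hD : D ∈ Matrix.unitaryGroup β ℂ := by
    rw [Matrix.mem_unitaryGroup_iff']
    ext i j
    have h1 := congrFun (congrFun hg (Sum.inr i)) (Sum.inr j)
    simp only [Matrix.mul_apply, Fintype.sum_sum_type, Finset.univ_eq_empty, Finset.sum_empty, zero_add,
      Matrix.conjTranspose_apply, Matrix.fromBlocks_apply₂₂, Matrix.neg_apply, Matrix.one_apply, mul_neg, mul_ite,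
      mul_one, mul_zero, neg_mul, Finset.sum_neg_distrib, Finset.sum_ite_eq', Finset.mem_univ, if_true, neg_inj] at h1
    rw [Matrix.star_eq_conjTranspose, Matrix.mul_apply]
    simpa only [Matrix.conjTranspose_apply, Matrix.one_apply, D] using h1
  refine ⟨(1, ⟨D, hD⟩), Subtype.ext (Units.ext ?_)⟩
  rw [UForm.coe_kV]
  ext (i | i) (j | j)
  · exact isEmptyElim i
  · exact isEmptyElim i
  · exact isEmptyElim j
  · rfl

/-- `kV α β : U(α) × U(β) → U(α, β)` is a proper map (compact source, Hausdorff target). [folklore] -/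
theorem UForm.isProperMap_kV : IsProperMap (UForm.kV α β) := by
  haveI := compactSpace_matrixUnitaryGroup α
  haveI := compactSpace_matrixUnitaryGroup β
  exact UForm.continuous_kV.isProperMap

variable {P Q R S : Type*} [Fintype P] [DecidableEq P] [Fintype Q] [DecidableEq Q] [Fintype R] [DecidableEq R]
  [Fintype S] [DecidableEq S]

/-- `u ↦ det(u)^m` is continuous on `U(n)` for every integer `m` (`det u ≠ 0`). [folklore] -/
theorem continuous_det_zpow_unitaryGroup (n : Type*) [Fintype n] [DecidableEq n] (m : ℤ) :
    Continuous fun u : Matrix.unitaryGroup n ℂ => ((u : Matrix.unitaryGroup n ℂ) : Matrix n n ℂ).det ^ m :=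
  (Continuous.matrix_det (continuous_subtype_val (p := fun A : Matrix n n ℂ => A ∈ Matrix.unitaryGroup n ℂ))).zpow₀ m
    fun u => Or.inl fun h0 => by
      have h1 := norm_det_unitaryGroup u
      rw [h0, norm_zero] at h1
      exact zero_ne_one h1

/-- The determinant-power scalar `vacScalar e` is continuous on `K_V × K_W`. [folklore] -/
theorem continuous_vacScalar (e : VacExponents) : Continuous (vacScalar e : DPK P Q R S → ℂ) := by
  unfold vacScalar
  exact (((continuous_det_zpow_unitaryGroup P e.eP).comp (continuous_fst.comp continuous_fst)).mul
    ((continuous_det_zpow_unitaryGroup Q e.eQ).comp (continuous_snd.comp continuous_fst))).mul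
    (((continuous_det_zpow_unitaryGroup R e.eR).comp (continuous_fst.comp continuous_snd)).mul
      ((continuous_det_zpow_unitaryGroup S e.eS).comp (continuous_snd.comp continuous_snd)))

end CompactFactor

/-! ## 3. The junction `U(P,Q) × U(R,S)` -/

section Junction

variable {P Q R S : Type*} [Fintype P] [DecidableEq P] [Fintype Q] [DecidableEq Q] [Fintype R] [DecidableEq R]
  [Fintype S] [DecidableEq S]

/-- `(kV k₁, 1) = κ (k₁, 1)` in `G_∞`. [folklore] -/
theorem kV_one_eq_κ (k₁ : Matrix.unitaryGroup P ℂ × Matrix.unitaryGroup Q ℂ) :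
    ((UForm.kV P Q k₁, 1) : Ginf P Q R S) = κ P Q R S (k₁, 1) :=
  Prod.ext rfl (map_one (UForm.kV R S)).symm

/-- `(1, kV k₂) = κ (1, k₂)` in `G_∞`. [folklore] -/
theorem one_kV_eq_κ (k₂ : Matrix.unitaryGroup R ℂ × Matrix.unitaryGroup S ℂ) :
    ((1, UForm.kV R S k₂) : Ginf P Q R S) = κ P Q R S (1, k₂) :=
  Prod.ext (map_one (UForm.kV P Q)).symm rfl

/-- On `K_V × 1` the symplectic action is `realify ∘ dualPairι`. [cite: KonnoKonno2007, §3.1] -/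
theorem ι𝕎_kV_one_apply (k₁ : Matrix.unitaryGroup P ℂ × Matrix.unitaryGroup Q ℂ) (pq : PV (DPIdx P Q R S)) :
    ((ι𝕎 P Q R S (UForm.kV P Q k₁, 1)).1 : (PV (DPIdx P Q R S)) ≃ₗ[ℝ] PV (DPIdx P Q R S)) pq =
      realify (dualPairι ((k₁, 1) : DPK P Q R S)) pq := by
  rw [kV_one_eq_κ, ι𝕎_κ]
  rfl

/-- On `1 × K_W` the symplectic action is `realify ∘ dualPairι`. [cite: KonnoKonno2007, §3.1] -/
theorem ι𝕎_one_kV_apply (k₂ : Matrix.unitaryGroup R ℂ × Matrix.unitaryGroup S ℂ) (pq : PV (DPIdx P Q R S)) :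
    ((ι𝕎 P Q R S (1, UForm.kV R S k₂)).1 : (PV (DPIdx P Q R S)) ≃ₗ[ℝ] PV (DPIdx P Q R S)) pq =
      realify (dualPairι ((1, k₂) : DPK P Q R S)) pq := by
  rw [one_kV_eq_κ, ι𝕎_κ]
  rfl

/-- **(w1) for the junction, joint form.**  `ω` a representation of `U(P,Q) × U(R,S)` on `𝓢(ℝ^{DPIdx})`, covariant over
`ι𝕎` with unitary lifts and a continuous vacuum orbit on `K_V × K_W`; a hyperbolic one-parameter subgroup `a` of
`U(P,Q)` with an explicit jointly continuous covariant implementer family `W_A`, a Weyl element, and a proper surjective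
`KAK` map; `U(R,S)` compact (`kV R S` onto).  Then `(g, f) ↦ ω g f` is jointly continuous.
[cite: Folland1989, §4.2, the Schur remark p. 156; Prop. (4.39)] -/
theorem continuous_uncurry_junction (ω : Representation ℂ (Ginf P Q R S) (SR (DPIdx P Q R S)))
    (hcov : IsPhaseCovariantS
      (fun g => ⇑((ι𝕎 P Q R S g).1 : (PV (DPIdx P Q R S)) ≃ₗ[ℝ] PV (DPIdx P Q R S))) (fun g => ω g))
    (hlift : ∀ g, HasUnitaryLift[DPIdx P Q R S] (ω g))
    (hvac : Continuous fun k : DPK P Q R S => ω (κ P Q R S k) (hermitePi 0))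
    (a : ℝ → UForm P Q) (ha : ∀ s t, a (s + t) = a s * a t)
    {WA : ℝ → ((SR (DPIdx P Q R S)) →L[ℂ] SR (DPIdx P Q R S))}
    (hWA : IsPhaseCovariantS
      (fun t => ⇑((ι𝕎 P Q R S (a t, 1)).1 : (PV (DPIdx P Q R S)) ≃ₗ[ℝ] PV (DPIdx P Q R S)))
      (fun t => ((WA t : (SR (DPIdx P Q R S)) →L[ℂ] SR (DPIdx P Q R S)) :
        (SR (DPIdx P Q R S)) →ₗ[ℂ] SR (DPIdx P Q R S))))
    (hWAl : ∀ t, HasUnitaryLift[DPIdx P Q R S]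
      ((WA t : (SR (DPIdx P Q R S)) →L[ℂ] SR (DPIdx P Q R S)) : (SR (DPIdx P Q R S)) →ₗ[ℂ] SR (DPIdx P Q R S)))
    (hWAc : Continuous fun x : ℝ × SR (DPIdx P Q R S) => WA x.1 x.2)
    (hWA_add : ∀ s t f, WA (s + t) f = WA s (WA t f))
    (w : Matrix.unitaryGroup P ℂ × Matrix.unitaryGroup Q ℂ) (hw : ∀ t, UForm.kV P Q w * a t * (UForm.kV P Q w)⁻¹ = a (-t))
    (hm : IsProperMap fun p : (Matrix.unitaryGroup P ℂ × Matrix.unitaryGroup Q ℂ) × ℝ ×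
        (Matrix.unitaryGroup P ℂ × Matrix.unitaryGroup Q ℂ) => UForm.kV P Q p.1 * a p.2.1 * UForm.kV P Q p.2.2)
    (hsurj : Function.Surjective fun p : (Matrix.unitaryGroup P ℂ × Matrix.unitaryGroup Q ℂ) × ℝ ×
        (Matrix.unitaryGroup P ℂ × Matrix.unitaryGroup Q ℂ) => UForm.kV P Q p.1 * a p.2.1 * UForm.kV P Q p.2.2)
    (hW : Function.Surjective (UForm.kV R S)) :
    Continuous fun x : Ginf P Q R S × SR (DPIdx P Q R S) => ω x.1 x.2 := by
  -- the `U(P,Q)`-slice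
  have h₁ : Continuous fun x : UForm P Q × SR (DPIdx P Q R S) => ω (x.1, 1) x.2 := by
    have hvac₁ : Continuous fun k₁ : Matrix.unitaryGroup P ℂ × Matrix.unitaryGroup Q ℂ =>
        ω ((UForm.kV P Q k₁, 1) : Ginf P Q R S) (hermitePi 0) := by
      simp_rw [kV_one_eq_κ]
      exact hvac.comp (continuous_id.prodMk continuous_const)
    exact continuous_uncurry_of_kak_unitary (ι𝕎 := (ι𝕎 P Q R S).comp (MonoidHom.inl (UForm P Q) (UForm R S)))
      (ω.comp (MonoidHom.inl (UForm P Q) (UForm R S))) (fun g₁ p q f => hcov (g₁, 1) p q f)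
      (fun g₁ => hlift (g₁, 1)) (UForm.kV P Q) (fun k₁ => dualPairι ((k₁, 1) : DPK P Q R S))
      (continuous_dualPairι.comp (continuous_id.prodMk continuous_const)) (fun k₁ pq => ι𝕎_kV_one_apply k₁ pq)
      hvac₁ a ha hWA hWAl hWAc hWA_add w hw hm hsurj
  -- the compact `U(R,S)`-slice
  have h₂ : Continuous fun x : UForm R S × SR (DPIdx P Q R S) => ω (1, x.1) x.2 := by
    have hvac₂ : Continuous fun k₂ : Matrix.unitaryGroup R ℂ × Matrix.unitaryGroup S ℂ =>
        ω ((1, UForm.kV R S k₂) : Ginf P Q R S) (hermitePi 0) := by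
      simp_rw [one_kV_eq_κ]
      exact hvac.comp (continuous_const.prodMk continuous_id)
    exact continuous_uncurry_of_compact_unitary (ι𝕎 := (ι𝕎 P Q R S).comp (MonoidHom.inr (UForm P Q) (UForm R S)))
      (ω.comp (MonoidHom.inr (UForm P Q) (UForm R S))) (fun g₂ p q f => hcov (1, g₂) p q f)
      (fun g₂ => hlift (1, g₂)) (UForm.kV R S) UForm.isProperMap_kV hW (fun k₂ => dualPairι ((1, k₂) : DPK P Q R S))
      (continuous_dualPairι.comp (continuous_const.prodMk continuous_id)) (fun k₂ pq => ι𝕎_one_kV_apply k₂ pq) hvac₂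
  exact continuous_uncurry_prod ω h₁ h₂

/-- **The archimedean Weil datum of the junction from its algebraic clauses and the vacuum character** (boost in
`U(P,Q)`, `U(R,S)` compact): (w1) is DERIVED. [cite: Folland1989, §4.2, the Schur remark p. 156; Prop. (4.39)] -/
theorem isArchWeilDatum_junction (ω : Representation ℂ (Ginf P Q R S) (SR (DPIdx P Q R S)))
    (hcov : IsPhaseCovariantS
      (fun g => ⇑((ι𝕎 P Q R S g).1 : (PV (DPIdx P Q R S)) ≃ₗ[ℝ] PV (DPIdx P Q R S))) (fun g => ω g))
    (hlift : ∀ g, HasUnitaryLift[DPIdx P Q R S] (ω g))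
    (hvac : Continuous fun k : DPK P Q R S => ω (κ P Q R S k) (hermitePi 0))
    (a : ℝ → UForm P Q) (ha : ∀ s t, a (s + t) = a s * a t)
    {WA : ℝ → ((SR (DPIdx P Q R S)) →L[ℂ] SR (DPIdx P Q R S))}
    (hWA : IsPhaseCovariantS
      (fun t => ⇑((ι𝕎 P Q R S (a t, 1)).1 : (PV (DPIdx P Q R S)) ≃ₗ[ℝ] PV (DPIdx P Q R S)))
      (fun t => ((WA t : (SR (DPIdx P Q R S)) →L[ℂ] SR (DPIdx P Q R S)) :
        (SR (DPIdx P Q R S)) →ₗ[ℂ] SR (DPIdx P Q R S))))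
    (hWAl : ∀ t, HasUnitaryLift[DPIdx P Q R S]
      ((WA t : (SR (DPIdx P Q R S)) →L[ℂ] SR (DPIdx P Q R S)) : (SR (DPIdx P Q R S)) →ₗ[ℂ] SR (DPIdx P Q R S)))
    (hWAc : Continuous fun x : ℝ × SR (DPIdx P Q R S) => WA x.1 x.2)
    (hWA_add : ∀ s t f, WA (s + t) f = WA s (WA t f))
    (w : Matrix.unitaryGroup P ℂ × Matrix.unitaryGroup Q ℂ) (hw : ∀ t, UForm.kV P Q w * a t * (UForm.kV P Q w)⁻¹ = a (-t))
    (hm : IsProperMap fun p : (Matrix.unitaryGroup P ℂ × Matrix.unitaryGroup Q ℂ) × ℝ ×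
        (Matrix.unitaryGroup P ℂ × Matrix.unitaryGroup Q ℂ) => UForm.kV P Q p.1 * a p.2.1 * UForm.kV P Q p.2.2)
    (hsurj : Function.Surjective fun p : (Matrix.unitaryGroup P ℂ × Matrix.unitaryGroup Q ℂ) × ℝ ×
        (Matrix.unitaryGroup P ℂ × Matrix.unitaryGroup Q ℂ) => UForm.kV P Q p.1 * a p.2.1 * UForm.kV P Q p.2.2)
    (hW : Function.Surjective (UForm.kV R S)) :
    IsArchWeilDatum (ι𝕎 P Q R S) ω where
  continuous_apply f := (continuous_uncurry_junction ω hcov hlift hvac a ha hWA hWAl hWAc hWA_add w hw hm hsurj hW).comp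
    (continuous_id.prodMk (continuous_const (y := f)))
  covariant := hcov
  exists_lift := hlift

/-- **The same, with the vacuum hypothesis in the printed form** `ω(κ k) h₀ = vacScalar e k • h₀` (Konno–Konno's
Lemma 5.2: `K_V × K_W` acts on the Gaussian by a product of determinant powers).
[cite: KonnoKonno2007, Lemma 5.2; Folland1989, §4.2, the Schur remark p. 156] -/
theorem isArchWeilDatum_junction_of_vacScalar (ω : Representation ℂ (Ginf P Q R S) (SR (DPIdx P Q R S)))
    (hcov : IsPhaseCovariantS
      (fun g => ⇑((ι𝕎 P Q R S g).1 : (PV (DPIdx P Q R S)) ≃ₗ[ℝ] PV (DPIdx P Q R S))) (fun g => ω g))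
    (hlift : ∀ g, HasUnitaryLift[DPIdx P Q R S] (ω g))
    {e : VacExponents} (hvac : ∀ k : DPK P Q R S, ω (κ P Q R S k) (hermitePi 0) = vacScalar e k • hermitePi 0)
    (a : ℝ → UForm P Q) (ha : ∀ s t, a (s + t) = a s * a t)
    {WA : ℝ → ((SR (DPIdx P Q R S)) →L[ℂ] SR (DPIdx P Q R S))}
    (hWA : IsPhaseCovariantS
      (fun t => ⇑((ι𝕎 P Q R S (a t, 1)).1 : (PV (DPIdx P Q R S)) ≃ₗ[ℝ] PV (DPIdx P Q R S)))
      (fun t => ((WA t : (SR (DPIdx P Q R S)) →L[ℂ] SR (DPIdx P Q R S)) :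
        (SR (DPIdx P Q R S)) →ₗ[ℂ] SR (DPIdx P Q R S))))
    (hWAl : ∀ t, HasUnitaryLift[DPIdx P Q R S]
      ((WA t : (SR (DPIdx P Q R S)) →L[ℂ] SR (DPIdx P Q R S)) : (SR (DPIdx P Q R S)) →ₗ[ℂ] SR (DPIdx P Q R S)))
    (hWAc : Continuous fun x : ℝ × SR (DPIdx P Q R S) => WA x.1 x.2)
    (hWA_add : ∀ s t f, WA (s + t) f = WA s (WA t f))
    (w : Matrix.unitaryGroup P ℂ × Matrix.unitaryGroup Q ℂ) (hw : ∀ t, UForm.kV P Q w * a t * (UForm.kV P Q w)⁻¹ = a (-t))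
    (hm : IsProperMap fun p : (Matrix.unitaryGroup P ℂ × Matrix.unitaryGroup Q ℂ) × ℝ ×
        (Matrix.unitaryGroup P ℂ × Matrix.unitaryGroup Q ℂ) => UForm.kV P Q p.1 * a p.2.1 * UForm.kV P Q p.2.2)
    (hsurj : Function.Surjective fun p : (Matrix.unitaryGroup P ℂ × Matrix.unitaryGroup Q ℂ) × ℝ ×
        (Matrix.unitaryGroup P ℂ × Matrix.unitaryGroup Q ℂ) => UForm.kV P Q p.1 * a p.2.1 * UForm.kV P Q p.2.2)
    (hW : Function.Surjective (UForm.kV R S)) :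
    IsArchWeilDatum (ι𝕎 P Q R S) ω := by
  refine isArchWeilDatum_junction ω hcov hlift ?_ a ha hWA hWAl hWAc hWA_add w hw hm hsurj hW
  simp_rw [hvac]
  exact (continuous_vacScalar e).smul continuous_const

/-- **The purely compact junction** (definite places: both `kV` onto): covariance, unitary lifts and a continuous vacuum
orbit on `K_V × K_W` already give the datum. [cite: Folland1989, §4.2, the Schur remark p. 156; Prop. (4.39)] -/
theorem isArchWeilDatum_junction_of_compact (ω : Representation ℂ (Ginf P Q R S) (SR (DPIdx P Q R S)))
    (hcov : IsPhaseCovariantS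
      (fun g => ⇑((ι𝕎 P Q R S g).1 : (PV (DPIdx P Q R S)) ≃ₗ[ℝ] PV (DPIdx P Q R S))) (fun g => ω g))
    (hlift : ∀ g, HasUnitaryLift[DPIdx P Q R S] (ω g))
    (hvac : Continuous fun k : DPK P Q R S => ω (κ P Q R S k) (hermitePi 0))
    (hV : Function.Surjective (UForm.kV P Q)) (hW : Function.Surjective (UForm.kV R S)) :
    IsArchWeilDatum (ι𝕎 P Q R S) ω := by
  have hκ : IsProperMap (κ P Q R S) := by
    haveI := compactSpace_matrixUnitaryGroup P
    haveI := compactSpace_matrixUnitaryGroup Q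
    haveI := compactSpace_matrixUnitaryGroup R
    haveI := compactSpace_matrixUnitaryGroup S
    exact continuous_κ.isProperMap
  have hκs : Function.Surjective (κ P Q R S) := fun g => by
    obtain ⟨k₁, hk₁⟩ := hV g.1
    obtain ⟨k₂, hk₂⟩ := hW g.2
    exact ⟨(k₁, k₂), Prod.ext hk₁ hk₂⟩
  have hj := continuous_uncurry_of_compact_unitary ω hcov hlift (κ P Q R S) hκ hκs dualPairι continuous_dualPairι
    (fun k pq => by rw [ι𝕎_κ]; rfl) hvac
  exact
    { continuous_apply := fun f => hj.comp (continuous_id.prodMk (continuous_const (y := f)))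
      covariant := hcov
      exists_lift := hlift }

/-- **The purely compact junction, printed vacuum form.** [cite: KonnoKonno2007, Lemma 5.2; Folland1989, §4.2 p. 156] -/
theorem isArchWeilDatum_junction_of_compact_of_vacScalar (ω : Representation ℂ (Ginf P Q R S) (SR (DPIdx P Q R S)))
    (hcov : IsPhaseCovariantS
      (fun g => ⇑((ι𝕎 P Q R S g).1 : (PV (DPIdx P Q R S)) ≃ₗ[ℝ] PV (DPIdx P Q R S))) (fun g => ω g))
    (hlift : ∀ g, HasUnitaryLift[DPIdx P Q R S] (ω g))
    {e : VacExponents} (hvac : ∀ k : DPK P Q R S, ω (κ P Q R S k) (hermitePi 0) = vacScalar e k • hermitePi 0)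
    (hV : Function.Surjective (UForm.kV P Q)) (hW : Function.Surjective (UForm.kV R S)) :
    IsArchWeilDatum (ι𝕎 P Q R S) ω := by
  refine isArchWeilDatum_junction_of_compact ω hcov hlift ?_ hV hW
  simp_rw [hvac]
  exact (continuous_vacScalar e).smul continuous_const

end Junction

end RealDualPair

end Literature.RepresentationTheory.KonnoKonno2007
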